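import Summits.CriticalPhenomena.Ising3DConformalLimit.Theses.MonotoneBlocking
import Summits.CriticalPhenomena.Ising3DConformalLimit.Theses.MirrorHoelderCompactness
import Summits.CriticalPhenomena.Ising3DConformalLimit.Theorems.InversionUpgradeNormalised.Negative.LoadBearingHypotheses
import Summits.CriticalPhenomena.Ising3DConformalLimit.Theorems.InversionUpgradeNormalised.Negative.RedundantHypotheses
import Summits.CriticalPhenomena.Ising3DConformalLimit.Theorems.RotationUpgradeFromTwoPoint.Negative.LoadBearingHypotheses
import Summits.CriticalPhenomena.Ising3DConformalLimit.Theorems.MoebiusLimitExists.Negative.TwoPointPositivity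
import Literature.Probability.LatticeModels.GeneralisedFreeFamily
import Literature.Probability.LatticeModels.PointwiseScalingLimitScale
import Literature.Probability.LatticeModels.HighDimPointwiseTriviality

/-!
# Disproof of `LimitsAreConformal` (stmt-CriticalPhenomena-6154) — findings

Crux (route `MonotoneBlocking`, rank 5; shared VERBATIM with `MirrorHoelderCompactness`, rank 6 —
`crux_iff_mirror` is `Iff.rfl`):

  ∀ ρ Δ S, (H1) ρ > 0 on (0,1] → (H2) HasPointwiseScalingLimit (criticalCorr 3) ρ S →
    (H3) S = 0 off NonCoincident → (H4) IsNondegenerateTwoPoint S → (H5) IsTranslationInvariant S →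
    (H6) IsScaleCovariant Δ S → (i) IsRotationInvariant S ∧ (ii) IsInversionCovariant Δ S ∧ (iii) HasNontrivialU4 S.

**VERDICT (cdisprove cycle 1): NOT REFUTED — and not refutable short of disproving the summit.**
`¬ Crux` is EXACTLY "a normalised scale-covariant non-degenerate pointwise limit of the critical
`ℤ³` correlators EXISTS (item 1981) AND it is not `O(3)`-invariant, or not inversion covariant, or
Gaussian" (refuter vetting file `Cruxes/LimitsAreConformal/Vetting.lean`:
`limitsAreConformal_iff_exists_imp_summit : Crux ↔ (ExistsScaleCovariantLimit → Ising3DConformalLimit)`;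
strategist: `Crux ↔ stmt-1982 ∧ stmt-0636`, evidence `MonotoneBlockingLimitsAreConformalSplit.lean`).
No junk instance exists: by `hypotheses_satisfiable_iff` the hypotheses are satisfiable iff item 1981
holds, and then (uniqueness of full-filter limits up to `c^n`) they describe one family up to scale.
Everything below is sorry-free; there is no Lean near-miss — the residue is the open problem itself.

LANDED (Negative lane, `--supports stmt-CriticalPhenomena-6154`; import these rather than this workfile):
* p158969 `Summits/CriticalPhenomena/Ising3DConformalLimit/Theorems/LimitsAreConformal/Negative/Nondegeneracy.lean`
  (namespace `…Ising3DConformalLimit.LimitsAreConformalNegative`: `limitsAreConformal_false_without_nondegeneracy`,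
  `hasPointwiseScalingLimit_trivial`, `eq_trivial_of_degenerate`, `degenerate_clauses`,
  `limitsAreConformal_iff_split_nondegeneracy`);
* p159172 `…/Theorems/LimitsAreConformal/Negative/LoadBearingHypotheses.lean` (same namespace:
  `limitsAreConformal_iff_withoutPositivity`, `limitsAreConformal_false_without_isingLimit`,
  `rotation_clause_needs_lattice`, `inversion_clause_needs_lattice`, `u4_clause_needs_lattice`,
  `conjuncts_independent`, `limitsAreConformal_false_with_latticeLimit`,
  `limitsAreConformal_false_without_normalisation_of_exists`, `limitsAreConformal_iff_withoutTranslation`,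
  `limitsAreConformal_false_without_scaleCovariance_of_exists`, `hypotheses_satisfiable_iff`,
  `limitsAreConformal_iff_strong`, `conclusion_weight_forced`, `limitsAreConformalAt_iff_vacuous_of_five_le`).
Both ACCEPTED (commits 0b8937125bd0, 5fffe6dbeba0); kernel axioms {propext, Classical.choice, Quot.sound}.

## Index
* §0 TYPING: `crux_iff` (unfolding), `crux_iff_mirror` (the two route spellings are one term).
* §A LOAD-BEARING TABLE of (H1)–(H6) — which hypotheses a proof must use, with Lean witnesses:
  - (H1) COSMETIC: `iff_withoutPositivity` (odd critical correlators vanish, `m*(β_c)=0`; `|ρ|` has the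
    same limit; `ρ ≠ 0` eventually is forced by (H2)+(H4)).
  - (H2) LOAD-BEARING, unconditionally, and CLAUSE BY CLAUSE at every `Δ` of the Ising window:
    `false_without_isingLimit`; `rotation_clause_needs_lattice` (cubic decoy: (H3)–(H6), not (i));
    `inversion_clause_needs_lattice` (barrier `narrowFamily`: (H3)–(H6) + (i) + (iii), not (ii));
    `u4_clause_needs_lattice` (normalised generalised free field: (H3)–(H6) + (i) + (ii), not (iii)).
    So the three conjuncts are INDEPENDENT failures model-blindly: no two of them imply the third from
    the covariance predicates alone. `false_with_latticeLimit`: lattice PROVENANCE (limit of SOME lattice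
    family) does not rescue (H2) either — a proof must use properties specific to `criticalCorr 3`.
  - (H3) LOAD-BEARING given satisfiability (item 1981): `false_without_normalisation_of_exists`
    (decorate `S₃` on the coincident locus, where (H2) is blind; `S₃ ≡ 0` for normalised limits).
  - (H4) LOAD-BEARING, **unconditionally** — `false_without_nondegeneracy`: the degenerate
    renormalisation `ρ δ = δ` sends the critical correlators to the trivial family `(1,0,0,…)`, a
    GENUINE pointwise limit of `criticalCorr 3` with (H1)(H2)(H3)(H5)(H6), (i), (ii) and `U₄ ≡ 0`.
    CONTRAST: for the sibling cruxes 1982 (conjunct (ii)) and 8367 (rotations) (H4) is REDUNDANT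
    (`InversionUpgradeNormalisedNegative.crux_iff_withoutNondegeneracy`). Sharper:
    `eq_trivialFamily_of_degenerate` — under (H2)+(H3) EVERY degenerate instance IS the trivial family
    (MMS positivity propagation `isNondegenerateTwoPoint_iff_exists_pos`, Lebowitz + Griffiths in the
    limit, Aizenman–Newman Wick dichotomy), so `crux_iff_split_nondegeneracy`: (H4) matters ONLY for
    clause (iii); clauses (i),(ii) hold with (H4) deleted iff they hold with it.
  - (H5) REDUNDANT: `iff_withoutTranslation` (lattice translations pass to normalised limits).
  - (H6) LOAD-BEARING given satisfiability: `false_without_scaleCovariance_of_exists` (it is what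
    binds `Δ`: else (ii) would hold for `Δ` and `Δ+1`, `weight_unique_of_two`).
  - `hypotheses_satisfiable_iff`: (H1)∧…∧(H6) satisfiable ↔ `HyperoctahedralRP.ExistsScaleCovariantLimit`
    (item 1981; `0 < Δ` is automatic, `Δ ∈ [1/2,1]`).
* §B CONCLUSION AUDIT: `iff_strong` — the conclusion upgrades FOR FREE to full Möbius covariance
  `IsMoebiusCovariant Δ S`, `Δ ∈ [1/2,1]`, `S₀ ≡ 1`, odd orders `≡ 0`; `conclusion_weight_forced` — (ii)
  with ANY weight `Δ'` forces `Δ' = Δ` ("with the same Δ" costs nothing / cannot be relaxed usefully);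
  the origin guard of (ii) is necessary (`InversionUpgradeNormalisedNegative.not_unguarded`).
* §C DIMENSION SHARPNESS: `cruxAt_iff_vacuous_of_five_le` — the same statement on `ℤ^d`, `d ≥ 5`, holds
  iff its hypotheses are unsatisfiable (every non-degenerate limit is Gaussian there, tree theorem
  `limitConnectedFour_eq_zero_of_hasPointwiseScalingLimit_holds`): a proof for `d = 3` must use an input
  that FAILS for `d ≥ 5` (for (iii)); RP/GKS/Lebowitz/MMS/infrared bounds are dimension-uniform.
* §D WHY IT RESISTS (prose): (i) is CLOSED in tree (`limitRotationInvariant_proof ∘ HRP2Rigidity_of`,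
  items 1980/1979); (ii) = item 1982, (iii) = item 0636 under the crux hypotheses (strategist split,
  kernel-checked); their standing disprovers' files (`Theorems/InversionUpgradeNormalised/Negative/*`,
  `Cruxes/IsingEuclidUpgradeR4NonGaussian/Disproof.lean`) record that a refutation of (ii) needs a
  non-Möbius interacting Ising₃ limit and a refutation of (iii) needs a GAUSSIAN Ising₃ limit — each the
  negation of a famous conjecture, and each requiring EXISTENCE (1981) first. No finite/decidable
  instance: the statement is about continuum limits along the full filter `𝓝[>] 0`.
  Targets: payload `stuck_stubs` empty; the registered stubs are items 1982/0636 verbatim (own seats).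
-/

noncomputable section

namespace Summit.CriticalPhenomena.Ising3DConformalLimit.Cruxes.LimitsAreConformal.Disproof

open Literature.Probability.LatticeModels Literature.Barriers.CriticalPhenomena
open Filter Set Function EuclideanGeometry ScaleNotMoebius
open scoped Topology
open Summit.CriticalPhenomena.Ising3DConformalLimit.Theses
open Summit.CriticalPhenomena.Ising3DConformalLimit.RotationUpgradeFromTwoPointNegative
  (cubicFamily cubicLattice cubicFamily_eq_zero_of_not_mem cubicFamily_isNondegenerateTwoPoint
    cubicFamily_isTranslationInvariant cubicFamily_isScaleCovariant cubicFamily_not_isRotationInvariant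
    cubicFamily_hasPointwiseScalingLimit decorate decor decorate_lim decorate_nondeg decorate_transl
    decorate_scale swap01 coincidentTriple decor_swap_coincidentTriple decor_coincidentTriple
    criticalCorr_nonneg pairingSum_zero_kernel translation_redundant)
open Summit.CriticalPhenomena.Ising3DConformalLimit.InversionUpgradeNormalisedNegative
  (weight_unique_of_two delta_mem_Icc_of_hyp limit_zero_eq_one limit_odd_eq_zero inversion_weight_eq)
open Summit.CriticalPhenomena.Ising3DConformalLimit.MoebiusLimitExistsNegative
  (limit_two_nonneg isNondegenerateTwoPoint_iff_exists_pos normalised_nondeg normalised_translation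
    normalised_rotation normalised_inversion normalised_scale hasNontrivialU4_normalised_iff)

/-! ## §0 Typing -/

/-- The crux, by name (route `MonotoneBlocking` spelling). -/
abbrev Crux : Prop := MonotoneBlocking.LimitsAreConformal

/-- Unfolding of the crux (definitional). -/
theorem crux_iff : Crux ↔ ∀ (ρ : ℝ → ℝ) (Δ : ℝ) (S : CorrFamily 3), (∀ δ ∈ Set.Ioc (0:ℝ) 1, 0 < ρ δ) →
    HasPointwiseScalingLimit (criticalCorr 3) ρ S → (∀ n z, z ∉ NonCoincident 3 n → S n z = 0) →
    IsNondegenerateTwoPoint S → IsTranslationInvariant S → IsScaleCovariant Δ S →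
    IsRotationInvariant S ∧ IsInversionCovariant Δ S ∧ HasNontrivialU4 S :=
  Iff.rfl

/-- The `MirrorHoelderCompactness` spelling of the crux is the same term. -/
theorem crux_iff_mirror : Crux ↔ MirrorHoelderCompactness.LimitsAreConformal := Iff.rfl

/-! ## §A.4 (H4) non-degeneracy is LOAD-BEARING — unconditionally -/

/-- The trivial family `(1, 0, 0, …)`. -/
def trivialFamily : CorrFamily 3 := fun n _ => if n = 0 then 1 else 0

/-- `ρ δ = δ` renormalises the critical correlators to the trivial family: a GENUINE pointwise scaling
limit of `criticalCorr 3` (`|⟨∏σ⟩| ≤ 1`, so `|δⁿ⟨∏σ⟩| ≤ δ → 0` uniformly for `n ≥ 1`; the arity-`0`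
rescaled correlator is the constant `1`). [folklore] -/
theorem hasPointwiseScalingLimit_trivialFamily :
    HasPointwiseScalingLimit (criticalCorr 3) (fun δ => δ) trivialFamily := by
  intro n
  rcases Nat.eq_zero_or_pos n with rfl | hn
  · refine TendstoUniformlyOn.tendstoLocallyUniformlyOn (Metric.tendstoUniformlyOn_iff.2 ?_)
    intro ε hε
    refine Filter.Eventually.of_forall fun δ x _ => ?_
    rw [Summit.CriticalPhenomena.Ising3DConformalLimit.Theorems.MoebiusLimitOfTwoPointLaw.Negative.rescaledCorrelator_arity_zero]
    simp [trivialFamily, hε]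
  · refine TendstoUniformlyOn.tendstoLocallyUniformlyOn (Metric.tendstoUniformlyOn_iff.2 ?_)
    intro ε hε
    have hm : Set.Ioo (0:ℝ) (min 1 ε) ∈ 𝓝[>] (0:ℝ) := Ioo_mem_nhdsGT (lt_min one_pos hε)
    filter_upwards [hm] with δ hδ x _
    have hn0 : n ≠ 0 := hn.ne'
    simp only [trivialFamily, if_neg hn0, rescaledCorrelator_apply, Real.dist_eq, zero_sub, abs_neg,
      abs_mul, abs_pow, abs_of_pos hδ.1]
    have h1 : |criticalCorr 3 n fun i => latticeApprox δ (x i)| ≤ 1 := abs_criticalCorr_le_one le_rfl _ _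
    have hδ1 : δ < 1 := hδ.2.trans_le (min_le_left _ _)
    have hδε : δ < ε := hδ.2.trans_le (min_le_right _ _)
    calc δ ^ n * |criticalCorr 3 n fun i => latticeApprox δ (x i)| ≤ δ ^ n * 1 :=
          mul_le_mul_of_nonneg_left h1 (pow_nonneg hδ.1.le n)
      _ ≤ δ ^ 1 * 1 := by
          refine mul_le_mul_of_nonneg_right (pow_le_pow_of_le_one hδ.1.le hδ1.le hn) zero_le_one
      _ < ε := by simpa using hδε

/-- The trivial family is normalised (arity `0` has no coincident configurations). [folklore] -/
theorem trivialFamily_normalised (n : ℕ) (z : Fin n → EuclideanSpace ℝ (Fin 3))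
    (hz : z ∉ NonCoincident 3 n) : trivialFamily n z = 0 := by
  rcases Nat.eq_zero_or_pos n with rfl | hn
  · exact absurd ((mem_nonCoincident z).2 fun i => i.elim0) hz
  · simp [trivialFamily, hn.ne']

/-- The trivial family is translation invariant. [folklore] -/
theorem trivialFamily_isTranslationInvariant : IsTranslationInvariant trivialFamily := fun _ _ _ => rfl

/-- The trivial family is `O(3)` invariant. [folklore] -/
theorem trivialFamily_isRotationInvariant : IsRotationInvariant trivialFamily := fun _ _ _ => rfl

/-- The trivial family is scale covariant with EVERY weight. [folklore] -/
theorem trivialFamily_isScaleCovariant (Δ : ℝ) : IsScaleCovariant Δ trivialFamily := by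
  intro n c _ x
  rcases Nat.eq_zero_or_pos n with rfl | hn
  · simp [trivialFamily]
  · simp [trivialFamily, hn.ne']

/-- The trivial family is inversion covariant with EVERY weight. [folklore] -/
theorem trivialFamily_isInversionCovariant (Δ : ℝ) : IsInversionCovariant Δ trivialFamily := by
  intro n x _
  rcases Nat.eq_zero_or_pos n with rfl | hn
  · simp [trivialFamily]
  · simp [trivialFamily, hn.ne']

/-- The trivial family is degenerate. [folklore] -/
theorem not_isNondegenerateTwoPoint_trivialFamily : ¬ IsNondegenerateTwoPoint trivialFamily := fun h =>
  (h _ (zero_unitVec_mem_nonCoincident one_ne_zero)).ne' (by simp [trivialFamily])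

/-- The trivial family is Gaussian (`U₄ ≡ 0`). [folklore] -/
theorem not_hasNontrivialU4_trivialFamily : ¬ HasNontrivialU4 trivialFamily := by
  rintro ⟨x, -, hne⟩
  exact hne (by simp [limitConnectedFour, trivialFamily])

/-- The crux with (H4) `IsNondegenerateTwoPoint S` DELETED. -/
def CruxWithoutNondegeneracy : Prop :=
  ∀ (ρ : ℝ → ℝ) (Δ : ℝ) (S : CorrFamily 3), (∀ δ ∈ Set.Ioc (0:ℝ) 1, 0 < ρ δ) →
    HasPointwiseScalingLimit (criticalCorr 3) ρ S → (∀ n z, z ∉ NonCoincident 3 n → S n z = 0) →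
    IsTranslationInvariant S → IsScaleCovariant Δ S →
    IsRotationInvariant S ∧ IsInversionCovariant Δ S ∧ HasNontrivialU4 S

/-- **(H4) is load-bearing, unconditionally**: `limitsAreConformal_false_without_nondegeneracy`.
Witness `ρ δ = δ`, `S = (1,0,0,…)`, any `Δ` (here `Δ = 1/2`): all other hypotheses hold, (i) and (ii)
hold, (iii) fails. Any proof must use `S₂ > 0` — and by `crux_iff_split_nondegeneracy` only for (iii).
[folklore] -/
theorem false_without_nondegeneracy : ¬ CruxWithoutNondegeneracy := fun h =>
  not_hasNontrivialU4_trivialFamily (h (fun δ => δ) (1 / 2) trivialFamily (fun _ hδ => hδ.1)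
    hasPointwiseScalingLimit_trivialFamily trivialFamily_normalised trivialFamily_isTranslationInvariant
    (trivialFamily_isScaleCovariant _)).2.2

/-- Griffiths I in the limit at order `4`, for ANY renormalisation (even power). [cite: FriedliVelenik2017, Thm. 3.20] -/
theorem limit_four_nonneg {ρ : ℝ → ℝ} {S : CorrFamily 3}
    (hlim : HasPointwiseScalingLimit (criticalCorr 3) ρ S) {x : Fin 4 → EuclideanSpace ℝ (Fin 3)}
    (hx : x ∈ NonCoincident 3 4) : 0 ≤ S 4 x := by
  refine ge_of_tendsto' ((hlim 4).tendsto_at hx) fun δ => ?_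
  rw [rescaledCorrelator_apply]
  have h4 : 0 ≤ ρ δ ^ 4 := by positivity
  exact mul_nonneg h4 (criticalCorr_nonneg _)

/-- **Every degenerate instance IS the trivial family** (no symmetry hypothesis and no sign of `ρ`
needed): under (H2)+(H3), `¬` (H4) forces `S = (1,0,0,…)`. Positivity of `S₂` at one pair propagates to
all pairs (`isNondegenerateTwoPoint_iff_exists_pos`, Messager–Miracle-Solé + self-similarity of
full-filter limits), so `S₂ ≡ 0`; then `0 ≤ S₄ ≤ ΣS₂S₂ = 0` (Griffiths I, Lebowitz in the limit), and
the Aizenman–Newman Wick dichotomy (`eq_pairingSum_of_limitConnectedFour_eq_zero`) kills all even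
orders; odd orders vanish (`m*(β_c) = 0`), `S₀ ≡ 1`. [cite: AizenmanCDM2020, §7, Prop. 7.2] -/
theorem eq_trivialFamily_of_degenerate {ρ : ℝ → ℝ} {S : CorrFamily 3}
    (hlim : HasPointwiseScalingLimit (criticalCorr 3) ρ S)
    (hnorm : ∀ n z, z ∉ NonCoincident 3 n → S n z = 0) (hdeg : ¬ IsNondegenerateTwoPoint S) :
    S = trivialFamily := by
  have h2 : ∀ y, S 2 y = 0 := by
    intro y
    by_cases hy : y ∈ NonCoincident 3 2
    · refine le_antisymm ?_ (limit_two_nonneg hlim hy)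
      by_contra hlt
      push Not at hlt
      exact hdeg ((isNondegenerateTwoPoint_iff_exists_pos hlim).2 ⟨y, hy, hlt⟩)
    · exact hnorm 2 y hy
  have hU : ∀ z ∈ NonCoincident 3 4, limitConnectedFour S z = 0 := by
    intro z hz
    have hle := limitConnectedFour_nonpos_of_hasPointwiseScalingLimit (by norm_num) hlim hz
    have hge : 0 ≤ S 4 z := limit_four_nonneg hlim hz
    simp only [limitConnectedFour, h2, mul_zero, add_zero, sub_zero] at hle ⊢
    exact le_antisymm hle hge
  funext n x
  rcases Nat.even_or_odd n with hev | hodd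
  · obtain ⟨m, rfl⟩ : ∃ m, n = 2 * m := by
      obtain ⟨r, hr⟩ := hev
      exact ⟨r, by omega⟩
    rcases Nat.lt_or_ge m 2 with hm | hm
    · interval_cases m
      · show S 0 x = trivialFamily 0 x
        simp only [trivialFamily, if_true]
        exact limit_zero_eq_one hlim x
      · show S 2 x = trivialFamily 2 x
        simp [trivialFamily, h2 x]
    · have htriv : trivialFamily (2 * m) x = 0 := by
        have : 2 * m ≠ 0 := by omega
        simp [trivialFamily, this]
      rw [htriv]
      by_cases hx : x ∈ NonCoincident 3 (2 * m)
      · rw [hlim.eq_pairingSum_of_limitConnectedFour_eq_zero (by norm_num) hU hm hx]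
        have hk : (fun p q : EuclideanSpace ℝ (Fin 3) => S 2 ![p, q]) = fun _ _ => (0:ℝ) := by
          funext p q; exact h2 _
        rw [hk]
        exact pairingSum_zero_kernel (by omega) x
      · exact hnorm _ x hx
  · have htriv : trivialFamily n x = 0 := by
      have : n ≠ 0 := by rintro rfl; exact absurd hodd (by decide)
      simp [trivialFamily, this]
    rw [htriv]
    exact limit_odd_eq_zero hlim hnorm hodd x

/-- Degenerate instances satisfy (i) and (ii) (with every weight) and violate (iii). [folklore] -/
theorem degenerate_clauses {ρ : ℝ → ℝ} (Δ : ℝ) {S : CorrFamily 3}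
    (hlim : HasPointwiseScalingLimit (criticalCorr 3) ρ S)
    (hnorm : ∀ n z, z ∉ NonCoincident 3 n → S n z = 0) (hdeg : ¬ IsNondegenerateTwoPoint S) :
    IsRotationInvariant S ∧ IsInversionCovariant Δ S ∧ ¬ HasNontrivialU4 S := by
  obtain rfl := eq_trivialFamily_of_degenerate hlim hnorm hdeg
  exact ⟨trivialFamily_isRotationInvariant, trivialFamily_isInversionCovariant Δ,
    not_hasNontrivialU4_trivialFamily⟩

/-- **(H4) is load-bearing ONLY through clause (iii).** The crux is equivalent to the conjunction of
"clauses (i),(ii) WITHOUT the non-degeneracy hypothesis" and "clause (iii) with it". So a prover of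
(i)/(ii) may ignore (H4) (as the sibling disprovers of 8367/1982 found), a prover of (iii) may not.
[folklore] -/
theorem crux_iff_split_nondegeneracy :
    Crux ↔
      (∀ (ρ : ℝ → ℝ) (Δ : ℝ) (S : CorrFamily 3), (∀ δ ∈ Set.Ioc (0:ℝ) 1, 0 < ρ δ) →
        HasPointwiseScalingLimit (criticalCorr 3) ρ S → (∀ n z, z ∉ NonCoincident 3 n → S n z = 0) →
        IsTranslationInvariant S → IsScaleCovariant Δ S →
        IsRotationInvariant S ∧ IsInversionCovariant Δ S) ∧
      (∀ (ρ : ℝ → ℝ) (Δ : ℝ) (S : CorrFamily 3), (∀ δ ∈ Set.Ioc (0:ℝ) 1, 0 < ρ δ) →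
        HasPointwiseScalingLimit (criticalCorr 3) ρ S → (∀ n z, z ∉ NonCoincident 3 n → S n z = 0) →
        IsNondegenerateTwoPoint S → IsTranslationInvariant S → IsScaleCovariant Δ S →
        HasNontrivialU4 S) := by
  constructor
  · intro h
    refine ⟨fun ρ Δ S h1 h2 h3 h5 h6 => ?_,
      fun ρ Δ S h1 h2 h3 h4 h5 h6 => (h ρ Δ S h1 h2 h3 h4 h5 h6).2.2⟩
    by_cases h4 : IsNondegenerateTwoPoint S
    · exact ⟨(h ρ Δ S h1 h2 h3 h4 h5 h6).1, (h ρ Δ S h1 h2 h3 h4 h5 h6).2.1⟩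
    · have hc := degenerate_clauses Δ h2 h3 h4
      exact ⟨hc.1, hc.2.1⟩
  · rintro ⟨hA, hB⟩ ρ Δ S h1 h2 h3 h4 h5 h6
    exact ⟨(hA ρ Δ S h1 h2 h3 h5 h6).1, (hA ρ Δ S h1 h2 h3 h5 h6).2, hB ρ Δ S h1 h2 h3 h4 h5 h6⟩

/-! ## §A.1 (H1) positivity of `ρ` is COSMETIC -/

/-- The crux with NO condition on the renormalisation `ρ`. -/
def CruxWithoutPositivity : Prop :=
  ∀ (ρ : ℝ → ℝ) (Δ : ℝ) (S : CorrFamily 3),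
    HasPointwiseScalingLimit (criticalCorr 3) ρ S → (∀ n z, z ∉ NonCoincident 3 n → S n z = 0) →
    IsNondegenerateTwoPoint S → IsTranslationInvariant S → IsScaleCovariant Δ S →
    IsRotationInvariant S ∧ IsInversionCovariant Δ S ∧ HasNontrivialU4 S

/-- A limit with `S₂ > 0` forces `ρ δ ≠ 0` for all small `δ`. [folklore] -/
theorem eventually_ne_zero_of_limit {ρ : ℝ → ℝ} {S : CorrFamily 3}
    (hlim : HasPointwiseScalingLimit (criticalCorr 3) ρ S) (hnd : IsNondegenerateTwoPoint S) :
    ∀ᶠ δ in 𝓝[>] (0:ℝ), ρ δ ≠ 0 := by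
  have hx := zero_unitVec_mem_nonCoincident (one_ne_zero (α := ℝ))
  filter_upwards [((hlim 2).tendsto_at hx).eventually_const_lt (hnd _ hx)] with δ hδ h0
  rw [rescaledCorrelator_apply, h0] at hδ
  simp at hδ

/-- **(H1) is cosmetic**: `Crux ↔ CruxWithoutPositivity`. (Odd critical correlators vanish since
`m*(β_c) = 0`, so `|ρ|` has the same limit as `ρ`; `ρ ≠ 0` eventually by (H2)+(H4);
`HasPointwiseScalingLimit.exists_pos_renormalisation`.) A prover may fix any sign convention; a refuter
gains nothing from exotic `ρ`. [folklore] -/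
theorem iff_withoutPositivity : Crux ↔ CruxWithoutPositivity := by
  refine ⟨fun h ρ Δ S hlim hnorm hnd htr hsc => ?_,
    fun h ρ Δ S _ hlim hnorm hnd htr hsc => h ρ Δ S hlim hnorm hnd htr hsc⟩
  obtain ⟨ρ', hρ', hlim'⟩ := hlim.exists_pos_renormalisation
    (fun n hn y => criticalCorr_eq_zero_of_odd le_rfl hn y) (eventually_ne_zero_of_limit hlim hnd)
  exact h ρ' Δ S (fun δ _ => hρ' δ) hlim' hnorm hnd htr hsc

/-! ## §A.2 (H2) the Ising lattice clause is LOAD-BEARING — clause by clause -/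

/-- The crux with (H1)+(H2) DELETED (model-blind: `S` any family with (H3)–(H6)). -/
def CruxWithoutIsingLimit : Prop :=
  ∀ (Δ : ℝ) (S : CorrFamily 3), (∀ n z, z ∉ NonCoincident 3 n → S n z = 0) →
    IsNondegenerateTwoPoint S → IsTranslationInvariant S → IsScaleCovariant Δ S →
    IsRotationInvariant S ∧ IsInversionCovariant Δ S ∧ HasNontrivialU4 S

/-- **(H2) is load-bearing** (witness: the barrier family `ScaleNotMoebius.narrowFamily 1`, which has
(H3)–(H6), (i), (iii) and fails (ii)). [folklore] -/
theorem false_without_isingLimit : ¬ CruxWithoutIsingLimit := fun h =>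
  narrowFamily_not_isInversionCovariant one_pos
    (h 1 _ (narrowFamily_eq_zero_of_not_mem one_ne_zero) (narrowFamily_isNondegenerateTwoPoint 1)
      (narrowFamily_isTranslationInvariant 1) (narrowFamily_isScaleCovariant 1)).2.1

/-- **Clause (i) needs the lattice**, at every `Δ ≠ 0`: the cubic decoy has (H3)–(H6) and is not
`O(3)` invariant. [folklore] -/
theorem rotation_clause_needs_lattice {Δ : ℝ} (hΔ : Δ ≠ 0) :
    ∃ S : CorrFamily 3, (∀ n z, z ∉ NonCoincident 3 n → S n z = 0) ∧ IsNondegenerateTwoPoint S ∧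
      IsTranslationInvariant S ∧ IsScaleCovariant Δ S ∧ ¬ IsRotationInvariant S :=
  ⟨cubicFamily Δ, cubicFamily_eq_zero_of_not_mem hΔ, cubicFamily_isNondegenerateTwoPoint Δ,
    cubicFamily_isTranslationInvariant Δ, cubicFamily_isScaleCovariant Δ,
    cubicFamily_not_isRotationInvariant Δ⟩

/-- **Clause (ii) needs the lattice EVEN GIVEN (i) and (iii)**, at every `Δ > 0`: the barrier family
`narrowFamily Δ` has (H3)–(H6), is `O(3)` invariant and non-Gaussian, and is NOT inversion covariant.
[folklore] -/
theorem inversion_clause_needs_lattice {Δ : ℝ} (hΔ : 0 < Δ) :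
    ∃ S : CorrFamily 3, (∀ n z, z ∉ NonCoincident 3 n → S n z = 0) ∧ IsNondegenerateTwoPoint S ∧
      IsTranslationInvariant S ∧ IsScaleCovariant Δ S ∧ IsRotationInvariant S ∧ HasNontrivialU4 S ∧
      ¬ IsInversionCovariant Δ S :=
  ⟨narrowFamily Δ, narrowFamily_eq_zero_of_not_mem hΔ.ne', narrowFamily_isNondegenerateTwoPoint Δ,
    narrowFamily_isTranslationInvariant Δ, narrowFamily_isScaleCovariant Δ,
    narrowFamily_isRotationInvariant Δ, narrowFamily_hasNontrivialU4 Δ,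
    narrowFamily_not_isInversionCovariant hΔ⟩

open Classical in
/-- **Clause (iii) needs the lattice EVEN GIVEN (i) and (ii)**, at every `Δ`: the normalised
generalised free field of dimension `Δ` has (H3)–(H6), is fully Möbius covariant, and has `U₄ ≡ 0`.
So no list of covariance properties replaces the lattice clause for (iii). [cite: FrancescoMathieuSenechal1997, §4.3.1] -/
theorem u4_clause_needs_lattice (Δ : ℝ) :
    ∃ S : CorrFamily 3, (∀ n z, z ∉ NonCoincident 3 n → S n z = 0) ∧ IsNondegenerateTwoPoint S ∧
      IsTranslationInvariant S ∧ IsScaleCovariant Δ S ∧ IsRotationInvariant S ∧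
      IsInversionCovariant Δ S ∧ ¬ HasNontrivialU4 S := by
  refine ⟨fun n x => if x ∈ NonCoincident 3 n then gffFamily Δ n x else 0, fun n z hz => if_neg hz,
    normalised_nondeg (isNondegenerateTwoPoint_gff Δ), normalised_translation (isTranslationInvariant_gff Δ),
    normalised_scale (isScaleCovariant_gff Δ), normalised_rotation (isRotationInvariant_gff Δ),
    normalised_inversion (isInversionCovariant_gff Δ), ?_⟩
  rw [hasNontrivialU4_normalised_iff]
  exact not_hasNontrivialU4_gff Δ

/-- The three conjuncts are INDEPENDENT model-blindly (summary of the three witnesses): for every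
`Δ > 0` each conjunct fails for some family having (H3)–(H6) and the OTHER symmetry data listed.
[folklore] -/
theorem conjuncts_independent {Δ : ℝ} (hΔ : 0 < Δ) :
    (∃ S : CorrFamily 3, (∀ n z, z ∉ NonCoincident 3 n → S n z = 0) ∧ IsNondegenerateTwoPoint S ∧
      IsTranslationInvariant S ∧ IsScaleCovariant Δ S ∧ ¬ IsRotationInvariant S) ∧
    (∃ S : CorrFamily 3, (∀ n z, z ∉ NonCoincident 3 n → S n z = 0) ∧ IsNondegenerateTwoPoint S ∧
      IsTranslationInvariant S ∧ IsScaleCovariant Δ S ∧ IsRotationInvariant S ∧ HasNontrivialU4 S ∧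
      ¬ IsInversionCovariant Δ S) ∧
    (∃ S : CorrFamily 3, (∀ n z, z ∉ NonCoincident 3 n → S n z = 0) ∧ IsNondegenerateTwoPoint S ∧
      IsTranslationInvariant S ∧ IsScaleCovariant Δ S ∧ IsRotationInvariant S ∧
      IsInversionCovariant Δ S ∧ ¬ HasNontrivialU4 S) :=
  ⟨rotation_clause_needs_lattice hΔ.ne', inversion_clause_needs_lattice hΔ, u4_clause_needs_lattice Δ⟩

/-- The crux with `criticalCorr 3` weakened to an ARBITRARY lattice family `G`. -/
def CruxWithLatticeLimit : Prop :=
  ∀ (G : LatticeCorrFamily 3) (ρ : ℝ → ℝ) (Δ : ℝ) (S : CorrFamily 3), (∀ δ ∈ Set.Ioc (0:ℝ) 1, 0 < ρ δ) →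
    HasPointwiseScalingLimit G ρ S → (∀ n z, z ∉ NonCoincident 3 n → S n z = 0) →
    IsNondegenerateTwoPoint S → IsTranslationInvariant S → IsScaleCovariant Δ S →
    IsRotationInvariant S ∧ IsInversionCovariant Δ S ∧ HasNontrivialU4 S

/-- **Lattice PROVENANCE does not rescue (H2)**: being the full-filter scaling limit of SOME lattice
family (here the cubic decoy sampled on `ℤ³`, `ρ δ = δ⁻¹`) with (H1),(H3)–(H6) does not give (i). A proof
must use properties SPECIFIC to `criticalCorr 3` (reflection positivity of all orders, random currents,
switching), not "is a lattice limit". [folklore] -/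
theorem false_with_latticeLimit : ¬ CruxWithLatticeLimit := fun h =>
  cubicFamily_not_isRotationInvariant 1 (h (cubicLattice 1) (fun δ => δ ^ (-(1:ℝ))) 1 (cubicFamily 1)
    (fun _ hδ => Real.rpow_pos_of_pos hδ.1 _) (cubicFamily_hasPointwiseScalingLimit 1)
    (cubicFamily_eq_zero_of_not_mem one_ne_zero) (cubicFamily_isNondegenerateTwoPoint 1)
    (cubicFamily_isTranslationInvariant 1) (cubicFamily_isScaleCovariant 1)).1

/-! ## §A.3 (H3) normalisation is LOAD-BEARING (given satisfiability) -/

/-- The crux with (H3) `S = 0 off NonCoincident` DELETED. -/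
def CruxWithoutNormalisation : Prop :=
  ∀ (ρ : ℝ → ℝ) (Δ : ℝ) (S : CorrFamily 3), (∀ δ ∈ Set.Ioc (0:ℝ) 1, 0 < ρ δ) →
    HasPointwiseScalingLimit (criticalCorr 3) ρ S →
    IsNondegenerateTwoPoint S → IsTranslationInvariant S → IsScaleCovariant Δ S →
    IsRotationInvariant S ∧ IsInversionCovariant Δ S ∧ HasNontrivialU4 S

/-- Decorating a family with `S₃ ≡ 0` on the coincident locus of order `3` (the sibling disprover's
`decorate`, `Theorems/RotationUpgradeFromTwoPoint/Negative/CoincidentDecoration.lean`) destroys `O(3)`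
invariance: the coincident triple `(0,0,e₀)` versus its coordinate swap, values `1` versus `0`. [folklore] -/
theorem decorate_not_rot_of_three (Δ : ℝ) {S : CorrFamily 3} (h3 : ∀ x, S 3 x = 0) :
    ¬ IsRotationInvariant (decorate Δ S) := by
  intro h
  have key := h 3 swap01 coincidentTriple
  change S 3 (fun i => swap01 (coincidentTriple i)) + decor Δ (fun i => swap01 (coincidentTriple i)) =
    S 3 coincidentTriple + decor Δ coincidentTriple at key
  rw [h3, h3, decor_swap_coincidentTriple, decor_coincidentTriple] at key
  norm_num at key

/-- **(H3) is load-bearing as soon as the hypotheses are satisfiable** (item 1981,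
`HyperoctahedralRP.ExistsScaleCovariantLimit`): decorate the normalised limit at order `3` on the
coincident locus — (H2) is blind there (it only sees `NonCoincident`), (H1),(H4),(H5),(H6) survive, and
(i) fails. (A normalised limit has `S₃ ≡ 0`: odd orders vanish.) [folklore] -/
theorem false_without_normalisation_of_exists (hE : HyperoctahedralRP.ExistsScaleCovariantLimit) :
    ¬ CruxWithoutNormalisation := by
  obtain ⟨ρ, Δ, S, hρ, -, hlim, hnorm, hnd, htr, hsc⟩ := hE
  intro h
  have h3 : ∀ x, S 3 x = 0 := fun x => limit_odd_eq_zero hlim hnorm (by decide) x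
  exact decorate_not_rot_of_three Δ h3 (h ρ Δ (decorate Δ S) hρ (decorate_lim Δ hlim)
    (decorate_nondeg Δ hnd) (decorate_transl Δ htr) (decorate_scale hsc)).1

/-! ## §A.5 (H5) translation invariance is REDUNDANT -/

/-- **(H5) is redundant**: the crux is equivalent to its version with `IsTranslationInvariant S`
deleted (lattice translation invariance passes to normalised pointwise limits,
`RotationUpgradeFromTwoPointNegative.translation_redundant`). [cite: FriedliVelenik2017, Thm. 3.17] -/
theorem iff_withoutTranslation :
    Crux ↔ ∀ (ρ : ℝ → ℝ) (Δ : ℝ) (S : CorrFamily 3), (∀ δ ∈ Set.Ioc (0:ℝ) 1, 0 < ρ δ) →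
      HasPointwiseScalingLimit (criticalCorr 3) ρ S → (∀ n z, z ∉ NonCoincident 3 n → S n z = 0) →
      IsNondegenerateTwoPoint S → IsScaleCovariant Δ S →
      IsRotationInvariant S ∧ IsInversionCovariant Δ S ∧ HasNontrivialU4 S := by
  constructor
  · intro h ρ Δ S h1 h2 h3 h4 h6
    exact h ρ Δ S h1 h2 h3 h4 (translation_redundant h2 h3) h6
  · intro h ρ Δ S h1 h2 h3 h4 _ h6
    exact h ρ Δ S h1 h2 h3 h4 h6

/-! ## §A.6 (H6) scale covariance is LOAD-BEARING (given satisfiability): it binds `Δ` -/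

/-- The crux with (H6) `IsScaleCovariant Δ S` DELETED (`Δ` then only occurs in the conclusion). -/
def CruxWithoutScaleCovariance : Prop :=
  ∀ (ρ : ℝ → ℝ) (Δ : ℝ) (S : CorrFamily 3), (∀ δ ∈ Set.Ioc (0:ℝ) 1, 0 < ρ δ) →
    HasPointwiseScalingLimit (criticalCorr 3) ρ S → (∀ n z, z ∉ NonCoincident 3 n → S n z = 0) →
    IsNondegenerateTwoPoint S → IsTranslationInvariant S →
    IsRotationInvariant S ∧ IsInversionCovariant Δ S ∧ HasNontrivialU4 S

/-- **(H6) is load-bearing as soon as the hypotheses are satisfiable**: without it `Δ` is free, so (ii)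
would hold with weights `Δ` and `Δ + 1` for the same non-degenerate `S` — impossible
(`weight_unique_of_two`, pair `(e₀, 2e₀)`). [folklore] -/
theorem false_without_scaleCovariance_of_exists (hE : HyperoctahedralRP.ExistsScaleCovariantLimit) :
    ¬ CruxWithoutScaleCovariance := by
  obtain ⟨ρ, Δ, S, hρ, -, hlim, hnorm, hnd, htr, -⟩ := hE
  intro h
  have h1 := (h ρ Δ S hρ hlim hnorm hnd htr).2.1
  have h2 := (h ρ (Δ + 1) S hρ hlim hnorm hnd htr).2.1
  have := weight_unique_of_two hnd (h1 2) (h2 2)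
  linarith

/-! ## §A.7 Satisfiability of the hypotheses = item 1981 (no junk instance, no hidden vacuity) -/

/-- **The hypotheses (H1)–(H6) are jointly satisfiable iff `ExistsScaleCovariantLimit` (item 1981)**;
`0 < Δ` is automatic (`Δ ∈ [1/2,1]`, infrared bound + Simon–Lieb). So the crux is vacuous exactly when
1981 fails, and otherwise speaks about the (unique up to `c^n`) Ising₃ limit. [cite: Simon1980, Thm. 1] -/
theorem hypotheses_satisfiable_iff :
    (∃ (ρ : ℝ → ℝ) (Δ : ℝ) (S : CorrFamily 3), (∀ δ ∈ Set.Ioc (0:ℝ) 1, 0 < ρ δ) ∧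
      HasPointwiseScalingLimit (criticalCorr 3) ρ S ∧ (∀ n z, z ∉ NonCoincident 3 n → S n z = 0) ∧
      IsNondegenerateTwoPoint S ∧ IsTranslationInvariant S ∧ IsScaleCovariant Δ S) ↔
    HyperoctahedralRP.ExistsScaleCovariantLimit := by
  constructor
  · rintro ⟨ρ, Δ, S, h1, h2, h3, h4, h5, h6⟩
    exact ⟨ρ, Δ, S, h1, by linarith [(delta_mem_Icc_of_hyp h1 h2 h4 h6).1], h2, h3, h4, h5, h6⟩
  · rintro ⟨ρ, Δ, S, h1, -, h2, h3, h4, h5, h6⟩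
    exact ⟨ρ, Δ, S, h1, h2, h3, h4, h5, h6⟩

/-! ## §B Conclusion audit: free strengthening, forced weight -/

/-- **The conclusion upgrades for free**: the crux is equivalent to the version concluding full Möbius
covariance `IsMoebiusCovariant Δ S` (translations are (H5), rotations (i), dilations (H6), inversion
(ii)), non-Gaussianity, `Δ ∈ [1/2, 1]`, `S₀ ≡ 1` and vanishing odd orders. [cite: Simon1980, Thm. 1] -/
theorem iff_strong :
    Crux ↔ ∀ (ρ : ℝ → ℝ) (Δ : ℝ) (S : CorrFamily 3), (∀ δ ∈ Set.Ioc (0:ℝ) 1, 0 < ρ δ) →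
      HasPointwiseScalingLimit (criticalCorr 3) ρ S → (∀ n z, z ∉ NonCoincident 3 n → S n z = 0) →
      IsNondegenerateTwoPoint S → IsTranslationInvariant S → IsScaleCovariant Δ S →
      IsMoebiusCovariant Δ S ∧ HasNontrivialU4 S ∧ Δ ∈ Set.Icc (1 / 2 : ℝ) 1 ∧
        (∀ x, S 0 x = 1) ∧ (∀ n, Odd n → ∀ x, S n x = 0) := by
  constructor
  · intro h ρ Δ S h1 h2 h3 h4 h5 h6
    obtain ⟨hrot, hinv, hU⟩ := h ρ Δ S h1 h2 h3 h4 h5 h6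
    exact ⟨⟨⟨h5, hrot⟩, h6, hinv⟩, hU, delta_mem_Icc_of_hyp h1 h2 h4 h6,
      fun x => limit_zero_eq_one h2 x, fun n hn x => limit_odd_eq_zero h2 h3 hn x⟩
  · intro h ρ Δ S h1 h2 h3 h4 h5 h6
    obtain ⟨hM, hU, -⟩ := h ρ Δ S h1 h2 h3 h4 h5 h6
    exact ⟨hM.1.2, hM.2.2, hU⟩

/-- **The weight in (ii) is forced**: under (H3)–(H6) and (i), inversion covariance with ANY weight
`Δ'` gives `Δ' = Δ` — "with the same Δ" in the crux costs nothing, and proving (ii) "for some weight"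
proves it for `Δ`. [folklore] -/
theorem conclusion_weight_forced {Δ Δ' : ℝ} {S : CorrFamily 3}
    (hnorm : ∀ n z, z ∉ NonCoincident 3 n → S n z = 0) (hnd : IsNondegenerateTwoPoint S)
    (htr : IsTranslationInvariant S) (hsc : IsScaleCovariant Δ S) (hrot : IsRotationInvariant S)
    (hinv : IsInversionCovariant Δ' S) : Δ' = Δ :=
  inversion_weight_eq hnorm hnd ⟨htr, hrot⟩ hsc hinv

/-! ## §C Dimension sharpness: the same statement in `d ≥ 5` is vacuous-or-false -/

/-- The crux on `ℤ^d`. -/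
def CruxAt (d : ℕ) : Prop :=
  ∀ (ρ : ℝ → ℝ) (Δ : ℝ) (S : CorrFamily d), (∀ δ ∈ Set.Ioc (0:ℝ) 1, 0 < ρ δ) →
    HasPointwiseScalingLimit (criticalCorr d) ρ S → (∀ n z, z ∉ NonCoincident d n → S n z = 0) →
    IsNondegenerateTwoPoint S → IsTranslationInvariant S → IsScaleCovariant Δ S →
    IsRotationInvariant S ∧ IsInversionCovariant Δ S ∧ HasNontrivialU4 S

/-- `d = 3` is the crux. -/
theorem cruxAt_three_iff : CruxAt 3 ↔ Crux := Iff.rfl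

/-- **`d ≥ 5`: the same statement holds iff it is VACUOUS** (every non-degenerate pointwise limit of
`criticalCorr d`, `d ≥ 5`, has `U₄ ≡ 0`: tree theorem
`limitConnectedFour_eq_zero_of_hasPointwiseScalingLimit_holds`, Aizenman 1982 / Fröhlich 1982). So clause
(iii) on `ℤ³` is a `d < 4` phenomenon: a proof must use an input that FAILS in `d ≥ 5`, beyond RP, GKS,
Lebowitz, MMS and infrared bounds (all dimension-uniform). [cite: Aizenman1982, §1] -/
theorem cruxAt_iff_vacuous_of_five_le {d : ℕ} (hd : 5 ≤ d) :
    CruxAt d ↔ ¬ ∃ (ρ : ℝ → ℝ) (Δ : ℝ) (S : CorrFamily d), (∀ δ ∈ Set.Ioc (0:ℝ) 1, 0 < ρ δ) ∧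
      HasPointwiseScalingLimit (criticalCorr d) ρ S ∧ (∀ n z, z ∉ NonCoincident d n → S n z = 0) ∧
      IsNondegenerateTwoPoint S ∧ IsTranslationInvariant S ∧ IsScaleCovariant Δ S := by
  constructor
  · rintro h ⟨ρ, Δ, S, h1, h2, h3, h4, h5, h6⟩
    obtain ⟨x, hx, hne⟩ := (h ρ Δ S h1 h2 h3 h4 h5 h6).2.2
    exact hne (limitConnectedFour_eq_zero_of_hasPointwiseScalingLimit_holds hd ρ S h1 h2 h4 x hx)
  · intro h ρ Δ S h1 h2 h3 h4 h5 h6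
    exact absurd ⟨ρ, Δ, S, h1, h2, h3, h4, h5, h6⟩ h

end Summit.CriticalPhenomena.Ising3DConformalLimit.Cruxes.LimitsAreConformal.Disproof

end
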